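import Literature.Topology.FourManifolds.TrisectionFunctorGKStabilizationPi1
import Literature.Topology.FourManifolds.SurfaceGroupAmalgam
import Literature.Topology.FourManifolds.SphereTrisections
import Literature.AlgebraicTopology.FundamentalGroup.CellAttachmentKernel
import HarnessLib

/-!
# Iterating the Gay–Kirby stabilisation without re-marking: transfer of the free-basis datum,
# and the standard trisections of `S⁴` (fact (d′)) from an on-the-nose stabilisation step

Topic `Literature/Topology/FourManifolds`; fact seat
`provefact-Literature.Topology.FourManifolds.sphere-99d675ea90` (named fact (d′)
`Literature.Topology.FourManifolds.sphere_gkTrisections`, `TrisectionFunctorGK.lean`: for every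
`m` the round `S⁴` carries a balanced `(3 + 3m, 1 + m)`-trisection with corners whose kernel
triple is isomorphic to `s4Kernels.stabilizeIter m` — Gay–Kirby 2016, §2 and Lemma 10:
"Stabilizing the genus `0` trisection of `S⁴` gives a genus `3` trisection […] the standard
genus `3` trisection of `S⁴`", iterated; Abrams–Gay–Kirby 2018, Thm. 5: "connected sums of group
trisections map to connected sums of 4-manifold trisections").  Everything in this file is
**proved**; there are no definitions and no named facts.  (d′) itself is NOT discharged here.

## Why this file exists

The tree reduces (d′) to the stabilisation fact (c′) `exists_stabilized_gkTrisection`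
(`sphere_gkTrisections_of_genusZero`, `SphereTrisections.lean`), whose induction *re-marks* the
central surface before each stabilisation (`exists_marking_groupGKTrisectionOf_eq`) and therefore
needs (c′) for ALL markings `μ`.  As analysed in `TrisectionFunctorGKStabilization.lean`, (c′)
for all markings is the geometric stabilisation for ONE marking plus **Nielsen's theorem**
(every automorphism of `S_g` lifts to the free group), which is far from the tree.  (d′) needs
neither: it asks for ONE marking per genus.  The `π₁` stage of the geometric stabilisation
(`exists_marking_groupGKTrisectionOf_eq_stabilize`, `TrisectionFunctorGKStabilizationPi1.lean`)
computes the new kernel triple ON THE NOSE, `𝒢(h′, x₀, μ′) = 𝒢(h, x₀, μ₀).stabilize`, but only for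
the *geometric* marking `μ₀` determined by a **datum** on the old central surface `F`:

  `A = F ∖ D̊` closed, `C = ∂D ⊆ A` collared in `A`, `t` a generator of `π₁(C, x₀)`, and a free
  basis `θ_A : F⟨a₁, …, b_g⟩ ≃* π₁(A, x₀)` with `θ_A(r_g) = t` and `μ₀ ∘ mk = (A ⊆ F)_* ∘ θ_A`
  (hypotheses `hA … hθA, μ₀, hμ₀` of that theorem).

To iterate without Nielsen one must hand the SAME KIND OF DATUM for the output marking `μ′` to
the next step.  This file proves that such a datum is inherited, by Seifert–van Kampen, from the
old datum and from data living entirely inside the new piece `P ≅ Σ₃ ∖ disc` of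
`F′ = A ∪_C P` — i.e. inside the fixed local model of the stabilisation:

* `exists_freeBasis_union_of_closed_cover_collars` — **free basis of `π₁(A ∪_C Q)`.**  If
  `A`, `Q` are closed, meet exactly in the collared circle `C ∋ x₀` (`π₁(C, x₀) = ⟨t⟩`),
  `θ_A : F⟨a₁,…,b_g⟩ ≃* π₁(A, x₀)` is any isomorphism and `θ_Q : F⟨Option(a₁,…,b_h)⟩ ≃* π₁(Q, x₀)`
  is a free basis ONE OF WHOSE MEMBERS IS `t` (`θ_Q(none) = t`: e.g. `Q = P ∖ D̊′` for a disc
  `D′ ⊂ P̊`, a genus-`h` surface with the two boundary circles `C`, `∂D′`), then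
  `π₁(A ∪ Q, x₀)` is free on `a₁, …, b_{g+h}`, the first `g` handles read through `θ_A`, the
  last `h` through `θ_Q ∘ some` (van Kampen, `VanKampen.existsUnique_hom_of_closed_cover_collars`:
  the amalgam `F_{2g} ∗_ℤ (ℤ ∗ F_{2h})` over a free factor is `F_{2g} ∗ F_{2h}`, recognised by
  `freeGroup_exists_mulEquiv_of_coproduct`);
* `freeBasis_union_apply_surfaceRelator` — in that basis `r_{g+h} = ι(r_g) · σ(r_h)` reads
  `(Q ⊆ A ∪ Q)_* c` for `c = θ_Q(none · some(r_h))` (so `c = [∂D′]` as soon as the model `Q`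
  satisfies `t · ∏[aᵢ, bᵢ] = [∂D′]` in `π₁ Q`, the two-holed surface relation);
* `marking_comp_mk_eq_inclHom_comp_freeBasis` — **the output marking is geometric for the new
  datum**: if `μ′ : S_{g+3} ≃* π₁(W, x₀)` reads the first `g` handles through `θ_A` and the last
  three through `θ_P : F⟨a₁,…,b₃⟩ ≃* π₁(P, x₀)` (the conclusion of
  `exists_marking_of_closed_cover_collars`), `Q ⊆ P` and `θ_Q ∘ some` is `θ_P` read in `Q`,
  then `μ′ ∘ mk = (A ∪ Q ⊆ W)_* ∘ θ′` — literally hypothesis `hμ₀` of the next step, at the same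
  base point `x₀` (usable when the next seam circle `C′ = ∂D′` passes through `x₀`);
* `groupGKTrisectionOf_transport` — the kernel triple `𝒢(h, x, μ)` does not change when the
  marking is transported along a path in the central surface (change of base point commutes with
  inclusion-induced maps, Hatcher Prop. 1.5), and
  `marking_transport_comp_mk_eq`, `freeBasis_transport_apply_eq` — the same
  datum transported to a base point `x₁ ∈ C′` along a path inside `Q` (usable for any inner disc
  `D′ ⊂ P̊`);
* `exists_marking_groupGKTrisectionOf_eq_stabilize_datum` — **the `π₁` stage of one
  stabilisation step returning the datum for the next**: the assembled theorem of
  `TrisectionFunctorGKStabilizationPi1.lean` re-assembled so as to output, besides `μ′` with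
  `𝒢(h′, x₀, μ′) = 𝒢(h, x₀, μ₀).stabilize`, the glued free basis `θ′` of `π₁(A ∪ Q, x₀)` through
  which `μ′` reads;
* `sphere_gkTrisections_of_invariant_step` — **(d′) from an on-the-nose stabilisation step
  preserving an arbitrary invariant `Good` of marked balanced trisections of `S⁴`**, by induction
  from any genus-`0` instance (`groupGKTrisectionOf_genus_zero`, `trivialKernels_stabilize`): no
  re-marking, hence no Nielsen, and no appeal to (g′) (markings of central surfaces) beyond
  genus `0`.  With `Good` := "carries a datum as above", the theorems of this file reduce the
  step to the differential topology of ONE local model (the genus-`3` relative trisection of the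
  `4`-ball, glued into a corner chart around a point of `D`), its handle counts, and the `π₁`
  facts of its own pieces listed in `TrisectionFunctorGKStabilizationPi1.lean` together with the
  free basis `θ_Q` of the model piece `Q = P ∖ D̊′` — all independent of `g`.

## References

* D. Gay, R. Kirby, *Trisecting 4-manifolds*, Geom. Topol. 20 (2016) 3097–3132
  (arXiv:1205.1565): §2 (the trisections of `S⁴`, arXiv p. 5), Def. 8–9 and Lemma 10 (p. 3100).
  [GayKirby2016]
* A. Abrams, D. Gay, R. Kirby, *Group trisections and smooth 4-manifolds*, Geom. Topol. 22
  (2018) 1537–1545: Def. 2–3 (pp. 1539–1540), Thm. 5 (p. 1541). [AbramsGayKirby2018]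
* A. Hatcher, *Algebraic Topology*, CUP (2002): Prop. 1.5 (change of base point), Thm. 1.20
  (Seifert–van Kampen), §1.2 p. 51. [HatcherAT2002]
-/

noncomputable section

open Set Subgroup
open Literature.AlgebraicTopology.FundamentalGroup.VanKampen
open scoped Manifold ContDiff

namespace Literature.Topology.FourManifolds

universe u

/-! ### A free basis of `π₁(A ∪_C Q)` when the seam circle is a free generator on the `Q` side -/

section FreeBasis

variable {X : Type u} [TopologicalSpace X] {g h : ℕ}

/-- **Free basis of `π₁(A ∪_C Q, x₀)`.**  Let `A, Q ⊆ X` be closed, meeting exactly in `C ∋ x₀`,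
with collars of `C` on both sides (`C ⊆ C_A ⊆ A` open in `A` and strong deformation retracting
onto `C`, likewise in `Q`), `A`, `Q`, `C` path connected and `π₁(C, x₀)` generated by `t`.  Let
`θ_A : F⟨a₁,…,b_g⟩ ≃* π₁(A, x₀)` be an isomorphism and `θ_Q : F⟨Option(a₁,…,b_h)⟩ ≃* π₁(Q, x₀)`
an isomorphism with `θ_Q(none) = t` (read in `Q`).  Then for every `W = A ∪ Q` there is an
isomorphism `θ′ : F⟨a₁,…,b_{g+h}⟩ ≃* π₁(W, x₀)` which is `θ_A` followed by `π₁ A → π₁ W` on the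
first `g` handles and `θ_Q ∘ some` followed by `π₁ Q → π₁ W` on the last `h`: by Seifert–van
Kampen (`VanKampen.existsUnique_hom_of_closed_cover_collars`) `π₁ W` is the pushout of
`π₁ A ← π₁ C → π₁ Q`, and a pushout `G ∗_ℤ (ℤ ∗ H)` in which `ℤ` is a free factor of the right-hand
side is the free product `G ∗ H` (`freeGroup_exists_mulEquiv_of_coproduct`).  Typical case: `Q` a
compact surface of genus `h` with two boundary circles `C` and `C′`, based on `C`.
[cite: HatcherAT2002, Thm. 1.20 and Prop. 1.17] -/
theorem exists_freeBasis_union_of_closed_cover_collars {A Q C CA CQ OA OQ W : Set X}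
    (hA : IsClosed A) (hQ : IsClosed Q) (hCA : C ⊆ A) (hCQ : C ⊆ Q) (hC : A ∩ Q ⊆ C)
    (hOA : IsOpen OA) (hCAe : CA = A ∩ OA) (hCCA : C ⊆ CA)
    (hOQ : IsOpen OQ) (hCQe : CQ = Q ∩ OQ) (hCCQ : C ⊆ CQ)
    (hsdrA : Literature.AlgebraicTopology.Homotopy.IsStrongDeformationRetractOf C CA)
    (hsdrQ : Literature.AlgebraicTopology.Homotopy.IsStrongDeformationRetractOf C CQ)
    (hApc : IsPathConnected A) (hQpc : IsPathConnected Q) (hCpc : IsPathConnected C)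
    {x₀ : X} (hx₀ : x₀ ∈ C) (eW : A ∪ Q = W)
    (t : _root_.FundamentalGroup C ⟨x₀, hx₀⟩) (ht : Subgroup.closure {t} = ⊤)
    (θA : FreeGroup (surfaceGen g) ≃* _root_.FundamentalGroup A ⟨x₀, hCA hx₀⟩)
    (θQ : FreeGroup (Option (surfaceGen h)) ≃* _root_.FundamentalGroup Q ⟨x₀, hCQ hx₀⟩)
    (hθQ : θQ (FreeGroup.of none) = inclHomOfSubset hCQ x₀ hx₀ (hCQ hx₀) t) :
    ∃ (hxW : x₀ ∈ W) (hAW : A ⊆ W) (hQW : Q ⊆ W)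
      (θ' : FreeGroup (surfaceGen (g + h)) ≃* _root_.FundamentalGroup W ⟨x₀, hxW⟩),
      θ'.toMonoidHom.comp (genInclAdd g h) =
          (inclHomOfSubset hAW x₀ (hCA hx₀) hxW).comp θA.toMonoidHom ∧
        θ'.toMonoidHom.comp (genShiftAdd g h) =
          (inclHomOfSubset hQW x₀ (hCQ hx₀) hxW).comp
            (θQ.toMonoidHom.comp (FreeGroup.map some)) := by
  subst eW
  have hxA : x₀ ∈ A := hCA hx₀
  have hxQ : x₀ ∈ Q := hCQ hx₀
  have hxW : x₀ ∈ A ∪ Q := Or.inl hxA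
  refine ⟨hxW, subset_union_left, subset_union_right, ?_⟩
  set jA := inclHomOfSubset (subset_union_left : A ⊆ A ∪ Q) x₀ hxA hxW with hjA
  set jQ := inclHomOfSubset (subset_union_right : Q ⊆ A ∪ Q) x₀ hxQ hxW with hjQ
  -- the seam: `t` read through `A` and through `Q` agree in `π₁(A ∪ Q)`
  have hseam : jA (inclHomOfSubset hCA x₀ hx₀ hxA t) = jQ (inclHomOfSubset hCQ x₀ hx₀ hxQ t) := by
    rw [hjA, hjQ, inclHomOfSubset_inclHomOfSubset, inclHomOfSubset_inclHomOfSubset]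
  set u : FreeGroup (surfaceGen g) →* _root_.FundamentalGroup ↥(A ∪ Q) ⟨x₀, hxW⟩ :=
    jA.comp θA.toMonoidHom with hu
  set v : FreeGroup (surfaceGen h) →* _root_.FundamentalGroup ↥(A ∪ Q) ⟨x₀, hxW⟩ :=
    jQ.comp (θQ.toMonoidHom.comp (FreeGroup.map some)) with hv
  refine freeGroup_exists_mulEquiv_of_coproduct u v ?_ ?_
  · -- existence of the comparison map `π₁(A ∪ Q) → F_{g+h}` (van Kampen, existence half)
    let fA : _root_.FundamentalGroup A ⟨x₀, hxA⟩ →* FreeGroup (surfaceGen (g + h)) :=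
      (genInclAdd g h).comp θA.symm.toMonoidHom
    let w : FreeGroup (surfaceGen (g + h)) := fA (inclHomOfSubset hCA x₀ hx₀ hxA t)
    let fQ : _root_.FundamentalGroup Q ⟨x₀, hxQ⟩ →* FreeGroup (surfaceGen (g + h)) :=
      (FreeGroup.lift fun o : Option (surfaceGen h) =>
          Option.elim o w fun q => genShiftAdd g h (FreeGroup.of q)).comp θQ.symm.toMonoidHom
    have hfQnone : fQ (θQ (FreeGroup.of none)) = w := by
      simp [fQ]
    have hfQsome : ∀ q, fQ (θQ (FreeGroup.of (some q))) = genShiftAdd g h (FreeGroup.of q) := by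
      intro q
      simp [fQ]
    have compat : fA.comp (inclHomOfSubset hCA x₀ hx₀ hxA) =
        fQ.comp (inclHomOfSubset hCQ x₀ hx₀ hxQ) := by
      refine MonoidHom.eq_of_eqOn_dense ht ?_
      intro s hs
      rw [Set.mem_singleton_iff] at hs
      subst hs
      change fA (inclHomOfSubset hCA x₀ hx₀ hxA s) = fQ (inclHomOfSubset hCQ x₀ hx₀ hxQ s)
      rw [← hθQ, hfQnone]
    obtain ⟨Φ, ⟨hΦ₁, hΦ₂⟩, -⟩ := existsUnique_hom_of_closed_cover_collars hA hQ hCA hCQ hC hOA hCAe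
      hCCA hOQ hCQe hCCQ hsdrA hsdrQ hApc hQpc hCpc hx₀ fA fQ compat
    have hΦjA : Φ.comp jA = fA := hΦ₁
    have hΦjQ : Φ.comp jQ = fQ := hΦ₂
    refine ⟨Φ, ?_, ?_⟩
    · rw [hu, ← MonoidHom.comp_assoc, hΦjA]
      exact MonoidHom.ext fun x => by simp [fA]
    · rw [hv, ← MonoidHom.comp_assoc, hΦjQ]
      refine FreeGroup.ext_hom _ _ fun q => ?_
      change fQ (θQ (FreeGroup.map some (FreeGroup.of q))) = genShiftAdd g h (FreeGroup.of q)
      rw [FreeGroup.map.of, hfQsome]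
  · -- uniqueness of endomorphisms on the images of `π₁ A` and `π₁ Q` (van Kampen, uniqueness half)
    intro F F' hFu hFv
    have hθAs : Function.Surjective θA.toMonoidHom := θA.surjective
    have hθQs : Function.Surjective θQ.toMonoidHom := θQ.surjective
    refine hom_ext_of_closed_cover_collars hA hQ hCA hCQ hC hOA hCAe hCCA hOQ hCQe hCCQ hsdrA hsdrQ
      hApc hQpc hCpc hx₀ ?_ ?_
    · rw [← MonoidHom.cancel_right hθAs, MonoidHom.comp_assoc, MonoidHom.comp_assoc, ← hjA, ← hu]
      exact hFu
    · rw [← MonoidHom.cancel_right hθQs, MonoidHom.comp_assoc, MonoidHom.comp_assoc, ← hjQ]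
      refine FreeGroup.ext_hom _ _ fun o => ?_
      cases o with
      | none =>
        -- `θ_Q(none) = t` is also `t` read through `A`, on which `F`, `F'` agree by `hFu`
        have e := DFunLike.congr_fun hFu (θA.symm (inclHomOfSubset hCA x₀ hx₀ hxA t))
        simp only [hu, MonoidHom.comp_apply, MulEquiv.coe_toMonoidHom,
          MulEquiv.apply_symm_apply] at e
        simp only [MonoidHom.comp_apply, MulEquiv.coe_toMonoidHom]
        rw [hθQ, ← hseam]
        exact e
      | some q =>
        have e := DFunLike.congr_fun hFv (FreeGroup.of q)
        simpa only [hv, MonoidHom.comp_apply, MulEquiv.coe_toMonoidHom, FreeGroup.map.of] using e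

/-- The same for `h = 3`, in the notation `genIncl g = ι`, `genShift g = σ` of
`TrisectionKernels.stabilize` (`genIncl_eq_genInclAdd`, `genShift_eq_genShiftAdd`).
[cite: HatcherAT2002, Thm. 1.20 and Prop. 1.17] -/
theorem exists_freeBasis_union_of_closed_cover_collars_three {A Q C CA CQ OA OQ W : Set X}
    (hA : IsClosed A) (hQ : IsClosed Q) (hCA : C ⊆ A) (hCQ : C ⊆ Q) (hC : A ∩ Q ⊆ C)
    (hOA : IsOpen OA) (hCAe : CA = A ∩ OA) (hCCA : C ⊆ CA)
    (hOQ : IsOpen OQ) (hCQe : CQ = Q ∩ OQ) (hCCQ : C ⊆ CQ)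
    (hsdrA : Literature.AlgebraicTopology.Homotopy.IsStrongDeformationRetractOf C CA)
    (hsdrQ : Literature.AlgebraicTopology.Homotopy.IsStrongDeformationRetractOf C CQ)
    (hApc : IsPathConnected A) (hQpc : IsPathConnected Q) (hCpc : IsPathConnected C)
    {x₀ : X} (hx₀ : x₀ ∈ C) (eW : A ∪ Q = W)
    (t : _root_.FundamentalGroup C ⟨x₀, hx₀⟩) (ht : Subgroup.closure {t} = ⊤)
    (θA : FreeGroup (surfaceGen g) ≃* _root_.FundamentalGroup A ⟨x₀, hCA hx₀⟩)
    (θQ : FreeGroup (Option (surfaceGen 3)) ≃* _root_.FundamentalGroup Q ⟨x₀, hCQ hx₀⟩)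
    (hθQ : θQ (FreeGroup.of none) = inclHomOfSubset hCQ x₀ hx₀ (hCQ hx₀) t) :
    ∃ (hxW : x₀ ∈ W) (hAW : A ⊆ W) (hQW : Q ⊆ W)
      (θ' : FreeGroup (surfaceGen (g + 3)) ≃* _root_.FundamentalGroup W ⟨x₀, hxW⟩),
      θ'.toMonoidHom.comp (genIncl g) =
          (inclHomOfSubset hAW x₀ (hCA hx₀) hxW).comp θA.toMonoidHom ∧
        θ'.toMonoidHom.comp (genShift g) =
          (inclHomOfSubset hQW x₀ (hCQ hx₀) hxW).comp
            (θQ.toMonoidHom.comp (FreeGroup.map some)) :=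
  exists_freeBasis_union_of_closed_cover_collars hA hQ hCA hCQ hC hOA hCAe hCCA hOQ hCQe hCCQ hsdrA
    hsdrQ hApc hQpc hCpc hx₀ eW t ht θA θQ hθQ

/-- **The surface relator in the glued basis.**  In the situation of
`exists_freeBasis_union_of_closed_cover_collars`, if moreover `θ_A(r_g) = t` (read in `A`), then
`θ′(r_{g+h}) = θ′(ι r_g · σ r_h)` is the class `(Q ⊆ W)_* c` of `c := θ_Q(none · some(r_h))`;
when `Q` is a genus-`h` surface with boundary circles `C` (reading `t = θ_Q(none)`) and `C′`, and
`θ_Q ∘ some` is a symplectic basis, `c` is the class of `C′` suitably based — the boundary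
relation `[C] · ∏[aᵢ, bᵢ] = [C′]` of the two-holed surface (Hatcher §1.2, p. 51).
[cite: HatcherAT2002, §1.2 p. 51] -/
theorem freeBasis_union_apply_surfaceRelator {A Q C W : Set X} (hCA : C ⊆ A) (hCQ : C ⊆ Q)
    {x₀ : X} (hx₀ : x₀ ∈ C) (hxW : x₀ ∈ W) (hAW : A ⊆ W) (hQW : Q ⊆ W)
    (t : _root_.FundamentalGroup C ⟨x₀, hx₀⟩)
    (θA : FreeGroup (surfaceGen g) ≃* _root_.FundamentalGroup A ⟨x₀, hCA hx₀⟩)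
    (θQ : FreeGroup (Option (surfaceGen h)) ≃* _root_.FundamentalGroup Q ⟨x₀, hCQ hx₀⟩)
    (hθA : θA (surfaceRelator g) = inclHomOfSubset hCA x₀ hx₀ (hCA hx₀) t)
    (hθQ : θQ (FreeGroup.of none) = inclHomOfSubset hCQ x₀ hx₀ (hCQ hx₀) t)
    (θ' : FreeGroup (surfaceGen (g + h)) ≃* _root_.FundamentalGroup W ⟨x₀, hxW⟩)
    (h₁ : θ'.toMonoidHom.comp (genInclAdd g h) =
      (inclHomOfSubset hAW x₀ (hCA hx₀) hxW).comp θA.toMonoidHom)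
    (h₂ : θ'.toMonoidHom.comp (genShiftAdd g h) =
      (inclHomOfSubset hQW x₀ (hCQ hx₀) hxW).comp (θQ.toMonoidHom.comp (FreeGroup.map some))) :
    θ' (surfaceRelator (g + h)) =
      inclHomOfSubset hQW x₀ (hCQ hx₀) hxW
        (θQ (FreeGroup.of none * FreeGroup.map some (surfaceRelator h))) := by
  have e₁ := DFunLike.congr_fun h₁ (surfaceRelator g)
  have e₂ := DFunLike.congr_fun h₂ (surfaceRelator h)
  simp only [MonoidHom.comp_apply, MulEquiv.coe_toMonoidHom] at e₁ e₂
  rw [surfaceRelator_add, map_mul, e₁, e₂, hθA, map_mul, hθQ, map_mul,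
    inclHomOfSubset_inclHomOfSubset, inclHomOfSubset_inclHomOfSubset]

/-- **The surface relator reads the next seam circle** (same base point).  If in the model piece
`Q` the class `θ_Q(none · some(r_h))` is the generator `t′` of `π₁(C′, x₀)` of a circle
`C′ ⊆ Q` through `x₀`, read in `Q`, then `θ′(r_{g+h}) = (C′ ⊆ W)_* t′` — hypothesis `hθA` of
`exists_marking_groupGKTrisectionOf_eq_stabilize` for the next stabilisation along `C′`.
[cite: HatcherAT2002, §1.2 p. 51] -/
theorem freeBasis_union_apply_surfaceRelator_eq_seam {A Q C C' W : Set X} (hCA : C ⊆ A)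
    (hCQ : C ⊆ Q) (hC'Q : C' ⊆ Q) {x₀ : X} (hx₀ : x₀ ∈ C) (hx₀C' : x₀ ∈ C') (hxW : x₀ ∈ W)
    (hAW : A ⊆ W) (hQW : Q ⊆ W)
    (t : _root_.FundamentalGroup C ⟨x₀, hx₀⟩) (t' : _root_.FundamentalGroup C' ⟨x₀, hx₀C'⟩)
    (θA : FreeGroup (surfaceGen g) ≃* _root_.FundamentalGroup A ⟨x₀, hCA hx₀⟩)
    (θQ : FreeGroup (Option (surfaceGen h)) ≃* _root_.FundamentalGroup Q ⟨x₀, hCQ hx₀⟩)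
    (hθA : θA (surfaceRelator g) = inclHomOfSubset hCA x₀ hx₀ (hCA hx₀) t)
    (hθQ : θQ (FreeGroup.of none) = inclHomOfSubset hCQ x₀ hx₀ (hCQ hx₀) t)
    (hθQ' : θQ (FreeGroup.of none * FreeGroup.map some (surfaceRelator h)) =
      inclHomOfSubset hC'Q x₀ hx₀C' (hCQ hx₀) t')
    (θ' : FreeGroup (surfaceGen (g + h)) ≃* _root_.FundamentalGroup W ⟨x₀, hxW⟩)
    (h₁ : θ'.toMonoidHom.comp (genInclAdd g h) =
      (inclHomOfSubset hAW x₀ (hCA hx₀) hxW).comp θA.toMonoidHom)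
    (h₂ : θ'.toMonoidHom.comp (genShiftAdd g h) =
      (inclHomOfSubset hQW x₀ (hCQ hx₀) hxW).comp (θQ.toMonoidHom.comp (FreeGroup.map some))) :
    θ' (surfaceRelator (g + h)) = inclHomOfSubset (hC'Q.trans hQW) x₀ hx₀C' hxW t' := by
  rw [freeBasis_union_apply_surfaceRelator hCA hCQ hx₀ hxW hAW hQW t θA θQ hθA hθQ θ' h₁ h₂, hθQ',
    inclHomOfSubset_inclHomOfSubset]

end FreeBasis

/-! ### The output marking is geometric for the glued basis -/

section MarkingCompat

variable {X : Type u} [TopologicalSpace X] {g : ℕ}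

/-- **The stabilised marking reads words through the glued free basis.**  Let
`A, Q ⊆ W′ ⊆ W` and `Q ⊆ P ⊆ W` (`W = A ∪ P` the new central surface, `W′ = A ∪ Q`, `Q = P` minus
the next open disc), all containing `x₀`.  If `μ′ : S_{g+3} ≃* π₁(W, x₀)` reads the first `g`
handles through `θ_A` and the last three through `θ_P` (the conclusion of
`exists_marking_of_closed_cover_collars`), `θ′ : F⟨a₁,…,b_{g+3}⟩ ≃* π₁(W′, x₀)` reads them
through `θ_A` and `θ_Q ∘ some` (the conclusion of
`exists_freeBasis_union_of_closed_cover_collars_three`), and `θ_Q ∘ some` pushed into `P` is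
`θ_P`, then `μ′ ∘ mk = (W′ ⊆ W)_* ∘ θ′` — hypothesis `hμ₀` of
`exists_marking_groupGKTrisectionOf_eq_stabilize` for the next stabilisation, with `A ↦ W′`,
`θ_A ↦ θ′`, `μ₀ ↦ μ′` and the same base point. [cite: AbramsGayKirby2018, Def. 2–3 (pp. 1539–1540)] -/
theorem marking_comp_mk_eq_inclHom_comp_freeBasis {A Q P W' W : Set X}
    (hAW' : A ⊆ W') (hQW' : Q ⊆ W') (hW'W : W' ⊆ W) (hQP : Q ⊆ P) (hPW : P ⊆ W)
    {x₀ : X} (hxA : x₀ ∈ A) (hxQ : x₀ ∈ Q) (hxP : x₀ ∈ P) (hxW' : x₀ ∈ W') (hxW : x₀ ∈ W)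
    (θA : FreeGroup (surfaceGen g) ≃* _root_.FundamentalGroup A ⟨x₀, hxA⟩)
    (θQ : FreeGroup (Option (surfaceGen 3)) ≃* _root_.FundamentalGroup Q ⟨x₀, hxQ⟩)
    (θP : FreeGroup (surfaceGen 3) ≃* _root_.FundamentalGroup P ⟨x₀, hxP⟩)
    (θ' : FreeGroup (surfaceGen (g + 3)) ≃* _root_.FundamentalGroup W' ⟨x₀, hxW'⟩)
    (h₁ : θ'.toMonoidHom.comp (genIncl g) = (inclHomOfSubset hAW' x₀ hxA hxW').comp θA.toMonoidHom)
    (h₂ : θ'.toMonoidHom.comp (genShift g) =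
      (inclHomOfSubset hQW' x₀ hxQ hxW').comp (θQ.toMonoidHom.comp (FreeGroup.map some)))
    (hQPθ : (inclHomOfSubset hQP x₀ hxQ hxP).comp (θQ.toMonoidHom.comp (FreeGroup.map some)) =
      θP.toMonoidHom)
    (μ' : SurfaceGroup (g + 3) ≃* _root_.FundamentalGroup W ⟨x₀, hxW⟩)
    (hμ'A : μ'.toMonoidHom.comp ((PresentedGroup.mk _).comp (genIncl g)) =
      (inclHomOfSubset (hAW'.trans hW'W) x₀ hxA hxW).comp θA.toMonoidHom)
    (hμ'P : μ'.toMonoidHom.comp ((PresentedGroup.mk _).comp (genShift g)) =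
      (inclHomOfSubset hPW x₀ hxP hxW).comp θP.toMonoidHom) :
    μ'.toMonoidHom.comp (PresentedGroup.mk _) =
      (inclHomOfSubset hW'W x₀ hxW' hxW).comp θ'.toMonoidHom := by
  refine freeGroup_hom_ext_genIncl_genShift ?_ ?_
  · rw [MonoidHom.comp_assoc, hμ'A, MonoidHom.comp_assoc, h₁, ← MonoidHom.comp_assoc,
      inclHomOfSubset_comp]
  · rw [MonoidHom.comp_assoc, hμ'P, MonoidHom.comp_assoc, h₂, ← MonoidHom.comp_assoc,
      inclHomOfSubset_comp, ← hQPθ, ← MonoidHom.comp_assoc, inclHomOfSubset_comp]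

end MarkingCompat

/-! ### Change of base point: transporting the datum along a path -/

section Transport

variable {X : Type u} [TopologicalSpace X]

/-- **The kernel triple is invariant under transport of the marking along a path in the central
surface.**  For a Gay–Kirby trisection `S`, points `x₀, x₁` of `F = ⋂ l, S l` joined by a path
`δ` in `F`, and a marking `μ` at `x₀`, the marking `β_δ ∘ μ` at `x₁` (`β_δ` the change of base
point, Hatcher Prop. 1.5) has the same kernel triple: the inclusion-induced maps
`π₁(F) → π₁(Hᵢ)` commute with `β_δ` (`VanKampen.inclHomOfSubset_fundamentalGroupMulEquivOfPath`).
[cite: HatcherAT2002, Prop. 1.5] [cite: AbramsGayKirby2018, p. 1540 (the map 𝒢)] -/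
theorem groupGKTrisectionOf_transport [ChartedSpace (EuclideanSpace ℝ (Fin 4)) X] {g : ℕ}
    {k : Fin 3 → ℕ} {S : Fin 3 → Set X} (hS : IsGKTrisection X g k S) {x₀ x₁ : X}
    (hx₀ : x₀ ∈ ⋂ l, S l) (hx₁ : x₁ ∈ ⋂ l, S l) (δ : Path x₀ x₁) (hδ : ∀ s, δ s ∈ ⋂ l, S l)
    (μ : SurfaceGroup g ≃* _root_.FundamentalGroup (centralSurface S) ⟨x₀, hx₀⟩) :
    groupGKTrisectionOf hS ⟨x₁, hx₁⟩
        (μ.trans (_root_.FundamentalGroup.fundamentalGroupMulEquivOfPath (liftPath (⋂ l, S l) δ hδ))) =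
      groupGKTrisectionOf hS ⟨x₀, hx₀⟩ μ := by
  funext i
  ext γ
  rw [groupGKTrisectionOf_apply_eq_comap_ker_inclHomOfSubset hS x₁ hx₁,
    groupGKTrisectionOf_apply_eq_comap_ker_inclHomOfSubset hS x₀ hx₀]
  simp only [Subgroup.mem_comap, MonoidHom.mem_ker, MulEquiv.coe_toMonoidHom, MulEquiv.trans_apply]
  rw [inclHomOfSubset_fundamentalGroupMulEquivOfPath (iInter_subset_inter S i) hx₀ hx₁ δ hδ (μ γ),
    map_eq_one_iff _ (MulEquiv.injective _)]

/-- **Transporting the geometric marking.**  If `μ′ ∘ mk = (W′ ⊆ W)_* ∘ θ′` at `x₀`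
(`marking_comp_mk_eq_inclHom_comp_freeBasis`) and `γ` is a path in `W′` from `x₀` to `x₁`, then
the transported marking `β_γ ∘ μ′` of `W` at `x₁` and the transported basis `β_γ ∘ θ′` of
`π₁(W′, x₁)` satisfy the same relation (naturality of the change of base point, Hatcher
Prop. 1.5) — hypothesis `hμ₀` of the next stabilisation at the new base point `x₁`.
[cite: HatcherAT2002, Prop. 1.5] -/
theorem marking_transport_comp_mk_eq {n : ℕ} {W' W : Set X} (hW'W : W' ⊆ W) {x₀ x₁ : X}
    (hx₀ : x₀ ∈ W') (hx₁ : x₁ ∈ W') (hx₀W : x₀ ∈ W) (hx₁W : x₁ ∈ W)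
    (γ : Path x₀ x₁) (hγ : ∀ s, γ s ∈ W')
    (θ' : FreeGroup (surfaceGen n) ≃* _root_.FundamentalGroup W' ⟨x₀, hx₀⟩)
    (μ' : SurfaceGroup n ≃* _root_.FundamentalGroup W ⟨x₀, hx₀W⟩)
    (hμ' : μ'.toMonoidHom.comp (PresentedGroup.mk _) =
      (inclHomOfSubset hW'W x₀ hx₀ hx₀W).comp θ'.toMonoidHom) :
    (μ'.trans (_root_.FundamentalGroup.fundamentalGroupMulEquivOfPath
        (liftPath W γ fun s => hW'W (hγ s)))).toMonoidHom.comp (PresentedGroup.mk _) =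
      (inclHomOfSubset hW'W x₁ hx₁ hx₁W).comp
        (θ'.trans (_root_.FundamentalGroup.fundamentalGroupMulEquivOfPath
          (liftPath W' γ hγ))).toMonoidHom := by
  refine MonoidHom.ext fun x => ?_
  have e := DFunLike.congr_fun hμ' x
  simp only [MonoidHom.comp_apply, MulEquiv.coe_toMonoidHom] at e
  simp only [MonoidHom.comp_apply, MulEquiv.coe_toMonoidHom, MulEquiv.trans_apply]
  rw [e, inclHomOfSubset_fundamentalGroupMulEquivOfPath hW'W hx₀ hx₁ γ hγ (θ' x)]

/-- **Transporting the boundary reading.**  If `θ′(r) = (Q ⊆ W′)_* c` at `x₀`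
(`freeBasis_union_apply_surfaceRelator`), `γ` is a path in `Q` from `x₀` to `x₁ ∈ C′ ⊆ Q`, and
in `π₁(Q, x₁)` the transported class `β_γ c` is the generator `t′` of `π₁(C′, x₁)` read in `Q`
(a property of the model piece `Q` alone: `c` is freely homotopic in `Q` to the next seam
circle `C′`), then the transported basis reads `r ↦ (C′ ⊆ W′)_* t′` — hypothesis `hθA` of the
next stabilisation. [cite: HatcherAT2002, Prop. 1.5 and §1.2 p. 51] -/
theorem freeBasis_transport_apply_eq {α : Type*} {Q W' C' : Set X} (hQW' : Q ⊆ W')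
    (hC'Q : C' ⊆ Q) {x₀ x₁ : X} (hx₀ : x₀ ∈ Q) (hx₁C' : x₁ ∈ C') (hx₀W' : x₀ ∈ W')
    (γ : Path x₀ x₁) (hγ : ∀ s, γ s ∈ Q)
    (θ' : FreeGroup α ≃* _root_.FundamentalGroup W' ⟨x₀, hx₀W'⟩) (r : FreeGroup α)
    (c : _root_.FundamentalGroup Q ⟨x₀, hx₀⟩)
    (hr : θ' r = inclHomOfSubset hQW' x₀ hx₀ hx₀W' c)
    (t' : _root_.FundamentalGroup C' ⟨x₁, hx₁C'⟩)
    (hct' : _root_.FundamentalGroup.fundamentalGroupMulEquivOfPath (liftPath Q γ hγ) c =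
      inclHomOfSubset hC'Q x₁ hx₁C' (hC'Q hx₁C') t') :
    (θ'.trans (_root_.FundamentalGroup.fundamentalGroupMulEquivOfPath
        (liftPath W' γ fun s => hQW' (hγ s)))) r =
      inclHomOfSubset (hC'Q.trans hQW') x₁ hx₁C' (hQW' (hC'Q hx₁C')) t' := by
  rw [MulEquiv.trans_apply, hr,
    ← inclHomOfSubset_fundamentalGroupMulEquivOfPath hQW' hx₀ (hC'Q hx₁C') γ hγ c, hct',
    inclHomOfSubset_inclHomOfSubset]

end Transport

/-! ### The `π₁` stage of one stabilisation step, returning the datum for the next one -/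

section Step

variable {X : Type u} [TopologicalSpace X] [ChartedSpace (EuclideanSpace ℝ (Fin 4)) X]

/-- **One stabilisation step at the level of `π₁`, with the free-basis datum handed on.**  The
hypotheses up to `hkP` are verbatim those of `exists_marking_groupGKTrisectionOf_eq_stabilize`
(`TrisectionFunctorGKStabilizationPi1.lean`: the old trisection `S` with its datum
`(A, C, t, θ_A, μ₀)`, the new one `S′` with `⋂ S′ = A ∪_C P` and the closed-cover
descriptions of its handlebodies, and the geometric `π₁` inputs).  The additional data live in
the model piece `P ≅ Σ₃ ∖ disc`: a closed `Q` with `C ⊆ Q ⊆ P` (`P` minus the open disc to be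
replaced by the NEXT stabilisation), a collar of `C` in `Q`, and a free basis
`θ_Q : F⟨Option(a₁,…,b₃)⟩ ≃* π₁(Q, x₀)` with `θ_Q(none) = t` whose other members push to `θ_P`
in `P`.  Conclusion: a marking `μ′` of `⋂ S′` at `x₀` with
`𝒢(h′, x₀, μ′) = 𝒢(h, x₀, μ₀).stabilize` ON THE NOSE (as there), TOGETHER WITH a free basis `θ′`
of `π₁(A ∪ Q, x₀)` (first `g` handles through `θ_A`, last three through `θ_Q ∘ some`) through
which `μ′` reads: `μ′ ∘ mk = (A ∪ Q ⊆ ⋂ S′)_* ∘ θ′`.  With the boundary reading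
(`freeBasis_union_apply_surfaceRelator_eq_seam`, or `freeBasis_transport_apply_eq` /
`marking_transport_comp_mk_eq` after moving the base point inside `Q`) this is exactly the input
`(A ∪ Q, C′, t′, θ′, μ′)` of the same theorem for the next stabilisation — the step of
`sphere_gkTrisections_of_invariant_step`, iterated without re-marking (Gay–Kirby, Lemma 10;
Abrams–Gay–Kirby, Thm. 5: "connected sums of group trisections map to connected sums of
4-manifold trisections").
[cite: AbramsGayKirby2018, Def. 3 (p. 1540) and Thm. 5 (p. 1541)]
[cite: GayKirby2016, Def. 8 and Lemma 10 (p. 3100)] -/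
theorem exists_marking_groupGKTrisectionOf_eq_stabilize_datum {g : ℕ} {k k' : Fin 3 → ℕ}
    {S S' : Fin 3 → Set X} (h : IsGKTrisection X g k S) (h' : IsGKTrisection X (g + 3) k' S')
    {x₀ : X}
    -- the new central surface `F′ = A ∪_C P`
    {A P C CA CP OA OP : Set X}
    (hA : IsClosed A) (hP : IsClosed P) (hCA : C ⊆ A) (hCP : C ⊆ P) (hC : A ∩ P ⊆ C)
    (hOA : IsOpen OA) (hCAe : CA = A ∩ OA) (hCCA : C ⊆ CA)
    (hOP : IsOpen OP) (hCPe : CP = P ∩ OP) (hCCP : C ⊆ CP)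
    (hsdrCA : Literature.AlgebraicTopology.Homotopy.IsStrongDeformationRetractOf C CA)
    (hsdrCP : Literature.AlgebraicTopology.Homotopy.IsStrongDeformationRetractOf C CP)
    (hApc : IsPathConnected A) (hPpc : IsPathConnected P) (hCpc : IsPathConnected C)
    (hx₀ : x₀ ∈ C) (eF' : A ∪ P = ⋂ l, S' l) (hAF : A ⊆ ⋂ l, S l)
    (t : _root_.FundamentalGroup C ⟨x₀, hx₀⟩) (ht : Subgroup.closure {t} = ⊤)
    -- free bases and the old marking
    (θA : FreeGroup (surfaceGen g) ≃* _root_.FundamentalGroup A ⟨x₀, hCA hx₀⟩)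
    (θP : FreeGroup (surfaceGen 3) ≃* _root_.FundamentalGroup P ⟨x₀, hCP hx₀⟩)
    (hθA : θA (surfaceRelator g) = inclHomOfSubset hCA x₀ hx₀ (hCA hx₀) t)
    (hθP : θP (surfaceRelator 3) = (inclHomOfSubset hCP x₀ hx₀ (hCP hx₀) t)⁻¹)
    (μ₀ : SurfaceGroup g ≃* _root_.FundamentalGroup (centralSurface S) ⟨x₀, hAF (hCA hx₀)⟩)
    (hμ₀ : μ₀.toMonoidHom.comp (PresentedGroup.mk _) =
      (inclHomOfSubset hAF x₀ (hCA hx₀) (hAF (hCA hx₀))).comp θA.toMonoidHom)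
    -- the new handlebodies `H′ᵢ = A^Hᵢ ∪_{Eᵢ} B^Hᵢ`
    (AH BH E CAH CBH OAH OBH : Fin 3 → Set X)
    (hAH : ∀ i, IsClosed (AH i)) (hBH : ∀ i, IsClosed (BH i)) (hEAH : ∀ i, E i ⊆ AH i)
    (hEBH : ∀ i, E i ⊆ BH i) (hE : ∀ i, AH i ∩ BH i ⊆ E i)
    (hOAH : ∀ i, IsOpen (OAH i)) (hCAHe : ∀ i, CAH i = AH i ∩ OAH i) (hECAH : ∀ i, E i ⊆ CAH i)
    (hOBH : ∀ i, IsOpen (OBH i)) (hCBHe : ∀ i, CBH i = BH i ∩ OBH i) (hECBH : ∀ i, E i ⊆ CBH i)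
    (hsdrA : ∀ i, Literature.AlgebraicTopology.Homotopy.IsStrongDeformationRetractOf (E i) (CAH i))
    (hsdrB : ∀ i, Literature.AlgebraicTopology.Homotopy.IsStrongDeformationRetractOf (E i) (CBH i))
    (hAHpc : ∀ i, IsPathConnected (AH i)) (hBHpc : ∀ i, IsPathConnected (BH i))
    (hEpc : ∀ i, IsPathConnected (E i)) (hx₀E : ∀ i, x₀ ∈ E i)
    (hE1 : ∀ i, Subsingleton (_root_.FundamentalGroup (E i) ⟨x₀, hx₀E i⟩))
    (eH' : ∀ i, AH i ∪ BH i = S' (i + 1) ∩ S' (i + 2))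
    (hAAH : ∀ i, A ⊆ AH i) (hAHH : ∀ i, AH i ⊆ S (i + 1) ∩ S (i + 2)) (hPBH : ∀ i, P ⊆ BH i)
    -- the geometric `π₁` inputs
    (hsAH : ∀ i, Function.Surjective
      (inclHomOfSubset ((hAAH i).trans (hAHH i)) x₀ (hCA hx₀) (hAHH i (hAAH i (hCA hx₀)))))
    (hjA : ∀ i, Function.Injective
      (inclHomOfSubset (hAHH i) x₀ (hAAH i (hCA hx₀)) (hAHH i (hAAH i (hCA hx₀)))))
    (hsP : ∀ i, Function.Surjective (inclHomOfSubset (hPBH i) x₀ (hCP hx₀) (hPBH i (hCP hx₀))))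
    (hkP : ∀ i, (((inclHomOfSubset (hPBH i) x₀ (hCP hx₀) (hPBH i (hCP hx₀))).comp
        θP.toMonoidHom).ker : Set (FreeGroup (surfaceGen 3))) =
      (normalClosure (FreeGroup.of '' (s4Gens i : Set (surfaceGen 3)) ∪ {surfaceRelator 3}) :
        Set (FreeGroup (surfaceGen 3))))
    -- the datum for the next stabilisation: the model piece `Q = P ∖ D̊′` and its free basis
    {Q CQ OQ : Set X} (hQ : IsClosed Q) (hCQ : C ⊆ Q) (hQP : Q ⊆ P)
    (hOQ : IsOpen OQ) (hCQe : CQ = Q ∩ OQ) (hCCQ : C ⊆ CQ)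
    (hsdrCQ : Literature.AlgebraicTopology.Homotopy.IsStrongDeformationRetractOf C CQ)
    (hQpc : IsPathConnected Q)
    (θQ : FreeGroup (Option (surfaceGen 3)) ≃* _root_.FundamentalGroup Q ⟨x₀, hCQ hx₀⟩)
    (hθQ : θQ (FreeGroup.of none) = inclHomOfSubset hCQ x₀ hx₀ (hCQ hx₀) t)
    (hQPθ : (inclHomOfSubset hQP x₀ (hCQ hx₀) (hCP hx₀)).comp
      (θQ.toMonoidHom.comp (FreeGroup.map some)) = θP.toMonoidHom) :
    ∃ (hx₀' : x₀ ∈ ⋂ l, S' l)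
      (μ' : SurfaceGroup (g + 3) ≃* _root_.FundamentalGroup (centralSurface S') ⟨x₀, hx₀'⟩)
      (hxAQ : x₀ ∈ A ∪ Q) (hAQF' : A ∪ Q ⊆ ⋂ l, S' l)
      (θ' : FreeGroup (surfaceGen (g + 3)) ≃* _root_.FundamentalGroup ↥(A ∪ Q) ⟨x₀, hxAQ⟩),
      groupGKTrisectionOf h' ⟨x₀, hx₀'⟩ μ' =
          (groupGKTrisectionOf h ⟨x₀, hAF (hCA hx₀)⟩ μ₀).stabilize ∧
        θ'.toMonoidHom.comp (genIncl g) =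
          (inclHomOfSubset subset_union_left x₀ (hCA hx₀) hxAQ).comp θA.toMonoidHom ∧
        θ'.toMonoidHom.comp (genShift g) =
          (inclHomOfSubset subset_union_right x₀ (hCQ hx₀) hxAQ).comp
            (θQ.toMonoidHom.comp (FreeGroup.map some)) ∧
        μ'.toMonoidHom.comp (PresentedGroup.mk _) =
          (inclHomOfSubset hAQF' x₀ hxAQ hx₀').comp θ'.toMonoidHom := by
  -- the marking of the new central surface (verbatim from the assembled `π₁` stage)
  obtain ⟨hxW, hAW, hPW, μ', hμ'A, hμ'P⟩ := exists_marking_of_closed_cover_collars hA hP hCA hCP hC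
    hOA hCAe hCCA hOP hCPe hCCP hsdrCA hsdrCP hApc hPpc hCpc hx₀ eF' t ht θA θP hθA hθP
  -- its kernel triple, slot by slot
  have hK : groupGKTrisectionOf h' ⟨x₀, hxW⟩ μ' =
      (groupGKTrisectionOf h ⟨x₀, hAF (hCA hx₀)⟩ μ₀).stabilize := by
    refine funext fun i => ?_
    haveI := hE1 i
    have hWV : (⋂ l, S' l) ⊆ S' (i + 1) ∩ S' (i + 2) := iInter_subset_inter S' i
    rw [groupGKTrisectionOf_apply_eq_comap_ker_inclHomOfSubset h' x₀ hxW μ' i]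
    refine comap_ker_eq_stabilize_of_closed_covers (hAH i) (hBH i) (hEAH i) (hEBH i) (hE i) (hOAH i)
      (hCAHe i) (hECAH i) (hOBH i) (hCBHe i) (hECBH i) (hsdrA i) (hsdrB i) (hAHpc i) (hBHpc i)
      (hEpc i) (hx₀E i) (eH' i) (hCA hx₀) (hCP hx₀) hAF (iInter_subset_inter S i) (hAAH i) (hAHH i)
      (hPBH i) hAW hPW hWV θA.toMonoidHom θP.toMonoidHom μ₀ hμ₀ μ' hμ'A hμ'P _ i ?_ ?_ (hjA i) ?_
      (hkP i)
    · exact groupGKTrisectionOf_apply_eq_comap_ker_inclHomOfSubset h x₀ (hAF (hCA hx₀)) μ₀ i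
    · rw [MonoidHom.coe_comp, MulEquiv.coe_toMonoidHom]
      refine Function.Surjective.comp (fun y => ?_) θA.surjective
      obtain ⟨x, hx⟩ := hsAH i (inclHomOfSubset (hAHH i) x₀ (hAAH i (hCA hx₀))
        (hAHH i (hAAH i (hCA hx₀))) y)
      refine ⟨x, hjA i ?_⟩
      rw [inclHomOfSubset_inclHomOfSubset, hx]
    · rw [MonoidHom.coe_comp, MulEquiv.coe_toMonoidHom]
      exact (hsP i).comp θP.surjective
  -- the glued free basis of `π₁(A ∪ Q, x₀)` and the reading of `μ′` through it
  have hCAQ : A ∩ Q ⊆ C := fun x hx => hC ⟨hx.1, hQP hx.2⟩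
  obtain ⟨hxW', hAW', hQW', θ', h₁, h₂⟩ := exists_freeBasis_union_of_closed_cover_collars_three hA hQ
    hCA hCQ hCAQ hOA hCAe hCCA hOQ hCQe hCCQ hsdrCA hsdrCQ hApc hQpc hCpc hx₀ rfl t ht θA θQ hθQ
  have hAQF' : A ∪ Q ⊆ ⋂ l, S' l := union_subset hAW (hQP.trans hPW)
  refine ⟨hxW, μ', hxW', hAQF', θ', hK, h₁, h₂, ?_⟩
  exact marking_comp_mk_eq_inclHom_comp_freeBasis hAW' hQW' hAQF' hQP hPW (hCA hx₀) (hCQ hx₀)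
    (hCP hx₀) hxW' hxW θA θQ θP θ' h₁ h₂ hQPθ μ' hμ'A hμ'P

end Step

/-! ### (d′) from an on-the-nose stabilisation step preserving an invariant -/

section Sphere

/-- **The standard trisections of `S⁴` from an iterable stabilisation step.**  Let `Good` be any
property of marked balanced Gay–Kirby trisections of the round `S⁴` (e.g. "the central surface
carries a free-basis datum at the base point through which the marking reads",
`TrisectionFunctorGKStabilizationPi1.lean`).  Suppose some marked genus-`0` trisection is `Good`
(e.g. Gay–Kirby's `GayKirby.sphereSector` with `GayKirby.sphereSector_marking`,
`sphereSector_isBalancedGKTrisection_holds`), and that every `Good` marked `(g, k)`-trisection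
`(S, x₀, μ)` admits a `Good` marked `(g + 3, k + 1)`-trisection `(S′, x₀′, μ′)` with
`𝒢(h′, x₀′, μ′) = 𝒢(h, x₀, μ).stabilize` ON THE NOSE (Gay–Kirby's stabilisation, Lemma 10, with
Abrams–Gay–Kirby's computation of its group trisection, Thm. 5: "connected sums of group
trisections map to connected sums of 4-manifold trisections", in the form produced by
`exists_marking_groupGKTrisectionOf_eq_stabilize` together with the datum transfer of this file).
Then (d′) `sphere_gkTrisections` holds: by induction the `(m+1)`-st stabilisation is a `Good`
`(3 + 3m, 1 + m)`-trisection whose kernel triple EQUALS `s4Kernels.stabilizeIter m` (the genus-`0`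
triple is `trivialKernels`, `groupGKTrisectionOf_genus_zero`, and its stabilisation is `s4Kernels`,
`trivialKernels_stabilize`), in particular is isomorphic to it.  No re-marking occurs, so
neither Nielsen's theorem nor the marking fact (g′) is used.
[cite: GayKirby2016, §2 (arXiv p. 5) and Lemma 10 (p. 3100)] [cite: AbramsGayKirby2018, Thm. 5 (p. 1541)] -/
theorem sphere_gkTrisections_of_invariant_step
    (Good : ∀ (g k : ℕ) (S : Fin 3 → Set (Metric.sphere (0 : EuclideanSpace ℝ (Fin 5)) 1))
      (h : IsBalancedGKTrisection (Metric.sphere (0 : EuclideanSpace ℝ (Fin 5)) 1) g k S)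
      (x₀ : centralSurface S),
      (SurfaceGroup g ≃* _root_.FundamentalGroup (centralSurface S) x₀) → Prop)
    (base : ∃ (S : Fin 3 → Set (Metric.sphere (0 : EuclideanSpace ℝ (Fin 5)) 1))
      (h : IsBalancedGKTrisection (Metric.sphere (0 : EuclideanSpace ℝ (Fin 5)) 1) 0 0 S)
      (x₀ : centralSurface S)
      (μ : SurfaceGroup 0 ≃* _root_.FundamentalGroup (centralSurface S) x₀), Good 0 0 S h x₀ μ)
    (step : ∀ (g k : ℕ) (S : Fin 3 → Set (Metric.sphere (0 : EuclideanSpace ℝ (Fin 5)) 1))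
      (h : IsBalancedGKTrisection (Metric.sphere (0 : EuclideanSpace ℝ (Fin 5)) 1) g k S)
      (x₀ : centralSurface S)
      (μ : SurfaceGroup g ≃* _root_.FundamentalGroup (centralSurface S) x₀),
      Good g k S h x₀ μ →
        ∃ (S' : Fin 3 → Set (Metric.sphere (0 : EuclideanSpace ℝ (Fin 5)) 1))
          (h' : IsBalancedGKTrisection (Metric.sphere (0 : EuclideanSpace ℝ (Fin 5)) 1)
            (g + 3) (k + 1) S')
          (x₀' : centralSurface S')
          (μ' : SurfaceGroup (g + 3) ≃* _root_.FundamentalGroup (centralSurface S') x₀'),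
          Good (g + 3) (k + 1) S' h' x₀' μ' ∧
            groupGKTrisectionOf h' x₀' μ' = (groupGKTrisectionOf h x₀ μ).stabilize) :
    sphere_gkTrisections := by
  -- for every `m`, a `Good` `(3 + 3m, 1 + m)`-trisection whose triple IS `stabilizeIter m`
  suffices H : ∀ m : ℕ, ∃ (S : Fin 3 → Set (Metric.sphere (0 : EuclideanSpace ℝ (Fin 5)) 1))
      (h : IsBalancedGKTrisection (Metric.sphere (0 : EuclideanSpace ℝ (Fin 5)) 1)
        (3 + 3 * m) (1 + m) S)
      (x₀ : centralSurface S)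
      (μ : SurfaceGroup (3 + 3 * m) ≃* _root_.FundamentalGroup (centralSurface S) x₀),
      Good (3 + 3 * m) (1 + m) S h x₀ μ ∧ groupGKTrisectionOf h x₀ μ = s4Kernels.stabilizeIter m by
    intro m
    obtain ⟨S, h, x₀, μ, -, hK⟩ := H m
    exact ⟨S, h, x₀, μ, hK ▸ TrisectionKernels.Iso.refl _⟩
  intro m
  induction m with
  | zero =>
    obtain ⟨S₀, h₀, x₀, μ₀, hg₀⟩ := base
    obtain ⟨S₁, h₁, x₁, μ₁, hg₁, hK₁⟩ := step 0 0 S₀ h₀ x₀ μ₀ hg₀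
    rw [groupGKTrisectionOf_genus_zero, trivialKernels_stabilize] at hK₁
    exact ⟨S₁, h₁, x₁, μ₁, hg₁, hK₁⟩
  | succ m ih =>
    obtain ⟨S, h, x₀, μ, hg, hK⟩ := ih
    obtain ⟨S', h', x₀', μ', hg', hK'⟩ := step _ _ S h x₀ μ hg
    rw [hK] at hK'
    exact ⟨S', h', x₀', μ', hg', hK'⟩

end Sphere

end Literature.Topology.FourManifolds
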